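import Literature.NumberTheory.Sieve.DrappeauDispersionSkeleton
import Literature.NumberTheory.Sieve.DrappeauDispersionMainTerms
import HarnessLib

/-!
# Drappeau 2017, §5.3–§5.6: the dispersion bound assembled modulo its four estimates — proved

S. Drappeau, *Sums of Kloosterman sums in arithmetic progressions, and the error term in the
dispersion method*, Proc. London Math. Soc. (3) 114 (2017) 684–732 = arXiv:1504.05549
(`Drappeau2017`; held as `paper:arxiv-1504.05549`, §5.3 on chunk 18, §5.6 on chunk 21).

The proof of Proposition 5.3 (hence of **Theorem 5.1**,
`Literature.NumberTheory.Sieve.Drappeau2017_theorem51`) runs: (5.10)–(5.11)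
`|𝒟|² ≪ (∑_m α(m)τ(m)^{2A}) (𝒮₁ − 2 Re 𝒮₂ + 𝒮₃)`; §5.3.1 `𝒮₃ = α̂(0)X₃ + [err₃]`; §5.3.2
`𝒮₂ = α̂(0)X₂ + [err₂]`, `X₂ = X₃`; §§5.4–5.5 `𝒮₁ = α̂(0)X₁ + [err₁]` (Theorem 2.1 of the source);
§5.6 `X₁ − X₃ ≪ (log x)^{O(1)}(N + N²R⁻²)`; "Given `α̂(0) ≪ M`, our claimed estimate (5.11) is
proved".  This file PROVES the bookkeeping step that combines them: for the finite dispersion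
sums of `…DrappeauDispersionSkeleton` (`dispSum = 𝒟`, `dispS1, dispS2, dispS3 = 𝒮₁, 𝒮₂, 𝒮₃`) and
the main terms of `…DrappeauDispersionMainTerms` (`mainX1 = X₁`, `mainX3 = X₃ = X₂`,
`mainTermsDiff = X₁ − X₃`, identity `mainX1_sub_mainX3_eq`), and any real `A ≥ 0` (`= α̂(0)`),

`Re 𝒮₁ − 2 Re 𝒮₂ + Re 𝒮₃ ≤ |𝒮₁ − A X₁| + 2|𝒮₂ − A X₃| + |𝒮₃ − A X₃| + A |X₁ − X₃|`
(`re_dispS_combination_le`), hence (`norm_dispSum_sq_le_four_terms`)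

`|𝒟|² ≤ (∑_m w(m)t(m)²) · (|𝒮₁ − A X₁| + 2|𝒮₂ − A X₃| + |𝒮₃ − A X₃| + A |X₁ − X₃|)`.

The four terms are bounded respectively in §§5.4–5.5 (not formalised: Theorem 2.1 of the source),
`…DrappeauDispersionS2` / `…DrappeauDispersionS3` (reduction to the Poisson-summation estimates)
and `…DrappeauDispersionMainTermsBound` (proved).

## References

* S. Drappeau, Proc. London Math. Soc. (3) 114 (2017) 684–732, arXiv:1504.05549, §5.3
  (5.10)–(5.11), §5.6. [Drappeau2017]
-/

noncomputable section

open Finset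

namespace Literature.NumberTheory.Sieve

namespace Drappeau2017

/-- **`Re 𝒮₁ − 2Re 𝒮₂ + Re 𝒮₃` against the main terms**: for positive moduli and real `A ≥ 0`,
`Re 𝒮₁ − 2 Re 𝒮₂ + Re 𝒮₃ ≤ |𝒮₁ − A X₁| + 2 |𝒮₂ − A X₃| + |𝒮₃ − A X₃| + A |X₁ − X₃|`
(insert `𝒮ⱼ = A Xⱼ + (𝒮ⱼ − A Xⱼ)`, `X₂ = X₃`, and `X₁ − 2X₃ + X₃ = X₁ − X₃ = (5.21)`).
[cite: Drappeau2017, §5.3 (5.11), §5.6] -/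
theorem re_dispS_combination_le (R : ℝ) (a₁ a₂ : ℤ) {𝒬 : Finset ℕ} (h𝒬 : ∀ q ∈ 𝒬, 0 < q)
    (ℳ 𝒩 : Finset ℕ) (γ w : ℕ → ℝ) (β : ℕ → ℂ) {A : ℝ} (hA : 0 ≤ A) :
    (dispS1 a₁ a₂ 𝒬 ℳ 𝒩 γ w β).re - 2 * (dispS2 R a₁ a₂ 𝒬 ℳ 𝒩 γ w β).re +
        (dispS3 R a₁ a₂ 𝒬 ℳ 𝒩 γ w β).re ≤
      ‖dispS1 a₁ a₂ 𝒬 ℳ 𝒩 γ w β - A * mainX1 a₁ a₂ 𝒬 𝒩 γ β‖ +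
        2 * ‖dispS2 R a₁ a₂ 𝒬 ℳ 𝒩 γ w β - A * mainX3 R a₁ a₂ 𝒬 𝒩 γ β‖ +
        ‖dispS3 R a₁ a₂ 𝒬 ℳ 𝒩 γ w β - A * mainX3 R a₁ a₂ 𝒬 𝒩 γ β‖ +
        A * ‖mainTermsDiff R a₁ a₂ 𝒬 𝒩 γ β‖ := by
  have hid := mainX1_sub_mainX3_eq R a₁ a₂ h𝒬 𝒩 γ β
  set S1 := dispS1 a₁ a₂ 𝒬 ℳ 𝒩 γ w β with hS1
  set S2 := dispS2 R a₁ a₂ 𝒬 ℳ 𝒩 γ w β with hS2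
  set S3 := dispS3 R a₁ a₂ 𝒬 ℳ 𝒩 γ w β with hS3
  set X1 := mainX1 a₁ a₂ 𝒬 𝒩 γ β with hX1
  set X3 := mainX3 R a₁ a₂ 𝒬 𝒩 γ β with hX3
  set D := mainTermsDiff R a₁ a₂ 𝒬 𝒩 γ β with hD
  clear_value S1 S2 S3 X1 X3 D
  have e : S1.re - 2 * S2.re + S3.re =
      (S1 - A * X1).re - 2 * (S2 - A * X3).re + (S3 - A * X3).re + A * D.re := by
    rw [← hid]
    simp only [Complex.sub_re, Complex.mul_re, Complex.ofReal_re, Complex.ofReal_im, zero_mul,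
      sub_zero]
    ring
  rw [e]
  have h1 := (abs_le.1 (Complex.abs_re_le_norm (S1 - A * X1))).2
  have h2 := (abs_le.1 (Complex.abs_re_le_norm (S2 - A * X3))).1
  have h3 := (abs_le.1 (Complex.abs_re_le_norm (S3 - A * X3))).2
  have h4 : A * D.re ≤ A * ‖D‖ :=
    mul_le_mul_of_nonneg_left (abs_le.1 (Complex.abs_re_le_norm D)).2 hA
  linarith

/-- **The dispersion bound modulo its four estimates**: for real `γ`, `w, t ≥ 0` on `ℳ`,
`|α_m| ≤ t(m)w(m)`, moduli `q ≥ 1` and real `A ≥ 0`,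
`|𝒟|² ≤ (∑_m w(m)t(m)²) (|𝒮₁ − A X₁| + 2|𝒮₂ − A X₃| + |𝒮₃ − A X₃| + A |X₁ − X₃|)`.
[cite: Drappeau2017, §5.3 (5.10)–(5.11), §5.6] -/
theorem norm_dispSum_sq_le_four_terms (R : ℝ) (a₁ a₂ : ℤ) {𝒬 : Finset ℕ}
    (h𝒬 : ∀ q ∈ 𝒬, 0 < q) (ℳ 𝒩 : Finset ℕ) (γ w t : ℕ → ℝ) (α β : ℕ → ℂ)
    (hw : ∀ m ∈ ℳ, 0 ≤ w m) (ht : ∀ m ∈ ℳ, 0 ≤ t m) (hα : ∀ m ∈ ℳ, ‖α m‖ ≤ t m * w m)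
    {A : ℝ} (hA : 0 ≤ A) :
    ‖dispSum R a₁ a₂ 𝒬 ℳ 𝒩 γ α β‖ ^ 2 ≤
      (∑ m ∈ ℳ, w m * t m ^ 2) *
        (‖dispS1 a₁ a₂ 𝒬 ℳ 𝒩 γ w β - A * mainX1 a₁ a₂ 𝒬 𝒩 γ β‖ +
          2 * ‖dispS2 R a₁ a₂ 𝒬 ℳ 𝒩 γ w β - A * mainX3 R a₁ a₂ 𝒬 𝒩 γ β‖ +
          ‖dispS3 R a₁ a₂ 𝒬 ℳ 𝒩 γ w β - A * mainX3 R a₁ a₂ 𝒬 𝒩 γ β‖ +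
          A * ‖mainTermsDiff R a₁ a₂ 𝒬 𝒩 γ β‖) := by
  refine (norm_dispSum_sq_le R a₁ a₂ 𝒬 ℳ 𝒩 γ w t α β h𝒬 hw ht hα).trans ?_
  exact mul_le_mul_of_nonneg_left (re_dispS_combination_le R a₁ a₂ h𝒬 ℳ 𝒩 γ w β hA)
    (Finset.sum_nonneg fun m hm => mul_nonneg (hw m hm) (sq_nonneg _))

end Drappeau2017

end Literature.NumberTheory.Sieve

end
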